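import Literature.MathematicalPhysics.QuantumLattice.LiebWuFiniteBExistence
import Literature.MathematicalPhysics.QuantumLattice.LiebWuFiniteBUniqueness
import HarnessLib

/-!
# Lieb–Wu 2003, Lemma 1: the rapidity density decreases as the range `B` increases

Family `hubbard`. Lieb–Wu, PRL 20 (1968) 1445, statement (b) ("`M/N` is a monotonically increasing
function of `B` reaching a maximum of `½` at `B = ∞`") rests, in Physica A 321 (2003) 1, §5, on
**Lemma 1 (Monotonicity in B):** "When `B` increases with `Q` fixed, `σ(x)` decreases pointwise for all
`x ∈ ℝ`. Proof: Since `1 - Â` is fixed and positive, we see from the right side of (W) that the integral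
kernel of `Ŵ` is monotone decreasing in `B̂`. The lemma then follows from the representation (series)."
This file proves exactly that, for the Neumann-series solution `σ_S = liebWuSigmaAtS U Q S` of
`LiebWuFiniteBNeumannSeries` and ARBITRARY measurable ranges `S ⊆ S'` (printed case `[-B, B] ⊆ [-B', B']`,
and `S' = ℝ`):

* `liebWuWS_eq_sub`: the right side of (W), `Ŵh = u ∗ h - ½ r ∗ ((1 - 1_{(-a,a]}) · (K ∗ 1_S h))`
  (`Ŵ = R̂[K̂ - (1 - Â)K̂B̂]`, using `R̂K̂ = Û`, i.e. `K ∗ r = 2u`);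
* `liebWuWS_antitone_set`: `S ⊆ S'`, `h ≥ 0` ⇒ `Ŵ_{S'} h ≤ Ŵ_S h`;
* `liebWuNeumannTermS_antitone_set`, **`liebWuSigmaAtS_antitone_set`**: `S ⊆ S'` ⇒ `σ_{S'} ≤ σ_S` pointwise;
  in particular `liebWuSigmaAt U Q ≤ liebWuSigmaAtS U Q S` (the `B = ∞` density is the smallest).

It also records the consequences of Theorem 1 (uniqueness, `LiebWuFiniteBUniqueness`) for the functionals:
any solution with range `SΛ` has the `σ`, `ρ|_{[-Q,Q]}`, filling (15), down-spin density (16) and energy (17)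
of the Neumann pair. No named fact.

## References

* E. H. Lieb, F. Y. Wu, Physica A 321 (2003) 1–27 = arXiv:cond-mat/0207529, §5, Lemma 1, eqs. (W),
  (series), Theorem 1 (key `LiebWuPhysicaA2003`); PRL 20 (1968) 1445, statements (a), (b) (`LiebWuPRL1968`).
-/

noncomputable section

open MeasureTheory Set Real Filter intervalIntegral
open Literature.Analysis.SpecialFunctions
open scoped Convolution Topology

namespace Literature.MathematicalPhysics.QuantumLattice

namespace LiebWuRangeMono

variable {f g k : ℝ → ℝ} {B B' : ℝ}

/-- `t ↦ f(t) g(x - t)` is integrable for `f ∈ L¹`, `g` bounded continuous. [folklore] -/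
private theorem integrable_mul_sub₅ (hf : Integrable f) (hgc : Continuous g) (hgB : ∀ y, |g y| ≤ B)
    (x : ℝ) : Integrable fun t => f t * g (x - t) :=
  hf.mul_bdd (hgc.comp (continuous_const.sub continuous_id)).aestronglyMeasurable
    (Eventually.of_forall fun t => by rw [Real.norm_eq_abs]; exact hgB _)

/-- The convolution of integrable functions is integrable. [folklore] -/
private theorem integrable_conv₅ (hf : Integrable f) (hg : Integrable g) :
    Integrable (fun x => ∫ t, f t * g (x - t)) := by
  have h : (fun x => ∫ t, f t * g (x - t)) = f ⋆[ContinuousLinearMap.mul ℝ ℝ, volume] g := by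
    funext x; rw [convolution_def]; simp only [ContinuousLinearMap.mul_apply']
  rw [h]
  exact hf.integrable_convolution _ hg

/-- Associativity `((f ∗ g) ∗ k)(x) = (f ∗ (g ∗ k))(x)` for `f, g ∈ L¹`, `k` bounded continuous. [folklore] -/
private theorem conv_conv₅ (hf : Integrable f) (hgi : Integrable g) (hkc : Continuous k)
    (hkB : ∀ y, |k y| ≤ B') (x : ℝ) :
    ∫ y, (∫ z, f z * g (y - z)) * k (x - y) = ∫ z, f z * ∫ s, g s * k (x - z - s) := by
  have hprod : Integrable (fun p : ℝ × ℝ => f p.2 * g (p.1 - p.2))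
      ((volume : Measure ℝ).prod volume) :=
    hf.convolution_integrand (ContinuousLinearMap.mul ℝ ℝ) hgi
  have hkm : Continuous fun p : ℝ × ℝ => k (x - p.1) := hkc.comp (continuous_const.sub continuous_fst)
  have h := hprod.mul_bdd (c := B') hkm.aestronglyMeasurable
    (Eventually.of_forall fun p => by rw [Real.norm_eq_abs]; exact hkB _)
  have hF : Integrable (Function.uncurry fun y z => f z * g (y - z) * k (x - y))
      ((volume : Measure ℝ).prod volume) := h
  calc ∫ y, (∫ z, f z * g (y - z)) * k (x - y) = ∫ y, ∫ z, f z * g (y - z) * k (x - y) := by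
        refine MeasureTheory.integral_congr_ae (Eventually.of_forall fun y => ?_)
        exact (MeasureTheory.integral_mul_const (k (x - y)) _).symm
    _ = ∫ z, ∫ y, f z * g (y - z) * k (x - y) := integral_integral_swap hF
    _ = ∫ z, f z * ∫ s, g s * k (x - z - s) := by
        refine MeasureTheory.integral_congr_ae (Eventually.of_forall fun z => ?_)
        dsimp only
        rw [← MeasureTheory.integral_const_mul,
          ← integral_add_right_eq_self (fun y => f z * g (y - z) * k (x - y)) z]
        refine MeasureTheory.integral_congr_ae (Eventually.of_forall fun s => ?_)
        dsimp only
        rw [add_sub_cancel_right, show x - (s + z) = x - z - s by ring]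
        ring

end LiebWuRangeMono

open LiebWuRangeMono

section Lemma1

variable {U Q : ℝ} {S S' : Set ℝ} {h : ℝ → ℝ}

/-- **The right side of eq. (W): `Ŵ = R̂[K̂ - (1 - Â)K̂B̂]`**, in kernel form:
`Ŵh(x) = (h ∗ u)(x) - ½ ∫ (1 - 1_{(-a,a]}(y)) (1_S h ∗ K)(y) r(x - y) dy` (`R̂K̂ = Û`: `K ∗ r = 2u`).
[cite: LiebWuPhysicaA2003, §5, eq. (W)] -/
theorem liebWuWS_eq_sub (hU : 0 < U) (hS : MeasurableSet S) (hhi : Integrable h) (x : ℝ) :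
    liebWuWS U Q S h x = (∫ t, h t * fermiKernel (U / 4) (x - t)) -
      1 / 2 * ∫ y, (1 - (Ioc (-Real.sin Q) (Real.sin Q)).indicator (fun _ => (1 : ℝ)) y) *
        (∫ t, S.indicator h t * cauchyDensity (U / 4) (y - t)) * sechKernel (U / 4) (x - y) := by
  have hc : 0 < U / 4 := by positivity
  have hKi : Integrable (cauchyDensity (U / 4)) := integrable_cauchyDensity hc.le
  have hrc : Continuous (sechKernel (U / 4)) := continuous_sechKernel hc
  have hrB : ∀ y, |sechKernel (U / 4) y| ≤ 1 / (2 * (U / 4)) := fun y => by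
    rw [abs_of_pos (sechKernel_pos hc y)]; exact sechKernel_le hc y
  have huc : Continuous (fermiKernel (U / 4)) := continuous_fermiKernel hc
  have huB : ∀ y, |fermiKernel (U / 4) y| ≤ 1 / (2 * π * (U / 4)) := fun y => by
    rw [abs_of_nonneg (fermiKernel_nonneg hc y)]; exact fermiKernel_le hc y
  have hSi : Integrable (S.indicator h) := hhi.indicator hS
  have hSci : Integrable (Sᶜ.indicator h) := hhi.indicator hS.compl
  set A : ℝ → ℝ := (Ioc (-Real.sin Q) (Real.sin Q)).indicator (fun _ => (1 : ℝ)) with hA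
  have hA1 : ∀ y, |A y| ≤ 1 := fun y => by
    by_cases hy : y ∈ Ioc (-Real.sin Q) (Real.sin Q)
    · simp [hA, indicator_of_mem hy]
    · simp [hA, indicator_of_notMem hy]
  have hAm : AEStronglyMeasurable A volume := aestronglyMeasurable_const.indicator measurableSet_Ioc
  set G : ℝ → ℝ := fun y => ∫ t, S.indicator h t * cauchyDensity (U / 4) (y - t) with hG
  have hGi : Integrable G := integrable_conv₅ hSi hKi
  -- `(1_S h) ∗ u = ½ (1_S h ∗ K) ∗ r`
  have hGr : ∫ y, G y * sechKernel (U / 4) (x - y) = 2 * ∫ t, S.indicator h t * fermiKernel (U / 4) (x - t) := by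
    rw [hG, conv_conv₅ hSi hKi hrc hrB, ← MeasureTheory.integral_const_mul]
    refine MeasureTheory.integral_congr_ae (Eventually.of_forall fun t => ?_)
    dsimp only
    have hin : ∫ s, cauchyDensity (U / 4) s * sechKernel (U / 4) (x - t - s) = 2 * fermiKernel (U / 4) (x - t) := by
      rw [← integral_sub_left_eq_self (fun s => cauchyDensity (U / 4) s * sechKernel (U / 4) (x - t - s)) volume (x - t)]
      simp only [sub_sub_cancel]
      rw [show (fun s => cauchyDensity (U / 4) (x - t - s) * sechKernel (U / 4) s) =
        fun s => sechKernel (U / 4) s * cauchyDensity (U / 4) (x - t - s) from funext fun s => mul_comm _ _]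
      exact integral_sechKernel_mul_cauchyDensity hc (x - t)
    rw [hin]; ring
  -- `1_{Sᶜ} h ∗ u = h ∗ u - 1_S h ∗ u`
  have hsplit : ∫ t, Sᶜ.indicator h t * fermiKernel (U / 4) (x - t) =
      (∫ t, h t * fermiKernel (U / 4) (x - t)) - ∫ t, S.indicator h t * fermiKernel (U / 4) (x - t) := by
    rw [← integral_sub (integrable_mul_sub₅ hhi huc huB x) (integrable_mul_sub₅ hSi huc huB x)]
    refine MeasureTheory.integral_congr_ae (Eventually.of_forall fun t => ?_)
    beta_reduce
    by_cases ht : t ∈ S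
    · rw [indicator_of_notMem (show t ∉ Sᶜ from fun h' => h' ht), indicator_of_mem ht]; ring
    · rw [indicator_of_mem (mem_compl ht), indicator_of_notMem ht]; ring
  -- `∫ (1 - A) G r = ∫ G r - ∫ A G r`
  have hGri : Integrable fun y => G y * sechKernel (U / 4) (x - y) := integrable_mul_sub₅ hGi hrc hrB x
  have hAGri : Integrable fun y => A y * G y * sechKernel (U / 4) (x - y) := by
    have h1 : Integrable fun y => A y * G y :=
      hGi.bdd_mul hAm (Eventually.of_forall fun y => by rw [Real.norm_eq_abs]; exact hA1 y)
    exact integrable_mul_sub₅ h1 hrc hrB x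
  have h1A : ∫ y, (1 - A y) * G y * sechKernel (U / 4) (x - y) =
      (∫ y, G y * sechKernel (U / 4) (x - y)) - ∫ y, A y * G y * sechKernel (U / 4) (x - y) := by
    rw [← integral_sub hGri hAGri]
    refine MeasureTheory.integral_congr_ae (Eventually.of_forall fun y => ?_)
    ring
  rw [liebWuWS, liebWuW, hsplit, h1A, hGr]
  ring

/-- **Lemma 1, operator form: the kernel of `Ŵ` decreases as the range grows.** For measurable `S ⊆ S'`
and `h ≥ 0` integrable, `Ŵ_{S'} h ≤ Ŵ_S h` pointwise ("since `1 - Â` is fixed and positive … the integral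
kernel of `Ŵ` is monotone decreasing in `B̂`"). [cite: LiebWuPhysicaA2003, §5, Lemma 1] -/
theorem liebWuWS_antitone_set (hU : 0 < U) (hS : MeasurableSet S) (hS' : MeasurableSet S') (hSS' : S ⊆ S')
    (hhi : Integrable h) (hh0 : ∀ t, 0 ≤ h t) (x : ℝ) :
    liebWuWS U Q S' h x ≤ liebWuWS U Q S h x := by
  have hc : 0 < U / 4 := by positivity
  have hKc : Continuous (cauchyDensity (U / 4)) := continuous_cauchyDensity hc
  have hKi : Integrable (cauchyDensity (U / 4)) := integrable_cauchyDensity hc.le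
  have hKB : ∀ y, |cauchyDensity (U / 4) y| ≤ 1 / (π * (U / 4)) := fun y => by
    rw [abs_of_pos (cauchyDensity_pos hc y)]; exact cauchyDensity_le hc y
  have hrc : Continuous (sechKernel (U / 4)) := continuous_sechKernel hc
  have hrB : ∀ y, |sechKernel (U / 4) y| ≤ 1 / (2 * (U / 4)) := fun y => by
    rw [abs_of_pos (sechKernel_pos hc y)]; exact sechKernel_le hc y
  set A : ℝ → ℝ := (Ioc (-Real.sin Q) (Real.sin Q)).indicator (fun _ => (1 : ℝ)) with hA
  have hA01 : ∀ y, 0 ≤ A y ∧ A y ≤ 1 := fun y => by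
    by_cases hy : y ∈ Ioc (-Real.sin Q) (Real.sin Q)
    · simp [hA, indicator_of_mem hy]
    · simp [hA, indicator_of_notMem hy]
  have hAm : AEStronglyMeasurable A volume := aestronglyMeasurable_const.indicator measurableSet_Ioc
  -- `G_S ≤ G_{S'}` pointwise
  have hind : ∀ t, S.indicator h t ≤ S'.indicator h t := fun t =>
    indicator_le_indicator_of_subset hSS' (fun s => hh0 s) t
  have hGle : ∀ y, (∫ t, S.indicator h t * cauchyDensity (U / 4) (y - t)) ≤
      ∫ t, S'.indicator h t * cauchyDensity (U / 4) (y - t) := fun y =>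
    integral_mono (integrable_mul_sub₅ (hhi.indicator hS) hKc hKB y)
      (integrable_mul_sub₅ (hhi.indicator hS') hKc hKB y)
      fun t => mul_le_mul_of_nonneg_right (hind t) (cauchyDensity_pos hc _).le
  have hint : ∀ (R : Set ℝ), MeasurableSet R → Integrable fun y => (1 - A y) *
      (∫ t, R.indicator h t * cauchyDensity (U / 4) (y - t)) * sechKernel (U / 4) (x - y) := by
    intro R hR
    have hGi : Integrable fun y => ∫ t, R.indicator h t * cauchyDensity (U / 4) (y - t) :=
      integrable_conv₅ (hhi.indicator hR) hKi
    have h1 : Integrable fun y => (1 - A y) * ∫ t, R.indicator h t * cauchyDensity (U / 4) (y - t) :=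
      hGi.bdd_mul (aestronglyMeasurable_const.sub hAm) (c := 1) (Eventually.of_forall fun y => by
        rw [Real.norm_eq_abs, abs_le]; constructor <;> linarith [(hA01 y).1, (hA01 y).2])
    exact integrable_mul_sub₅ h1 hrc hrB x
  rw [liebWuWS_eq_sub hU hS hhi, liebWuWS_eq_sub hU hS' hhi]
  have hmono : ∫ y, (1 - A y) * (∫ t, S.indicator h t * cauchyDensity (U / 4) (y - t)) * sechKernel (U / 4) (x - y) ≤
      ∫ y, (1 - A y) * (∫ t, S'.indicator h t * cauchyDensity (U / 4) (y - t)) * sechKernel (U / 4) (x - y) :=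
    integral_mono (hint S hS) (hint S' hS') fun y => mul_le_mul_of_nonneg_right
      (mul_le_mul_of_nonneg_left (hGle y) (by linarith [(hA01 y).2])) (sechKernel_pos hc _).le
  linarith

/-- **Lemma 1 for the Neumann terms:** `S ⊆ S'` ⇒ `Ŵ_{S'}ⁿξ ≤ Ŵ_Sⁿξ` pointwise (induction: `Ŵ_{S'}` is monotone
and dominated by `Ŵ_S` on nonnegative functions). [cite: LiebWuPhysicaA2003, §5, Lemma 1] -/
theorem liebWuNeumannTermS_antitone_set (hU : 0 < U) (hQ : 0 < Q) (hS : MeasurableSet S)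
    (hS' : MeasurableSet S') (hSS' : S ⊆ S') (n : ℕ) (x : ℝ) :
    liebWuNeumannTermS U Q S' n x ≤ liebWuNeumannTermS U Q S n x := by
  induction n generalizing x with
  | zero => exact le_rfl
  | succ n ih =>
    obtain ⟨_, h0', hi', _⟩ := liebWuNeumannTermS_props hU hQ hS' n
    obtain ⟨_, h0, hi, _⟩ := liebWuNeumannTermS_props hU hQ hS n
    calc liebWuNeumannTermS U Q S' (n + 1) x = liebWuWS U Q S' (liebWuNeumannTermS U Q S' n) x := rfl
      _ ≤ liebWuWS U Q S' (liebWuNeumannTermS U Q S n) x := liebWuWS_mono hU hS' hi' hi h0' ih x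
      _ ≤ liebWuWS U Q S (liebWuNeumannTermS U Q S n) x := liebWuWS_antitone_set hU hS hS' hSS' hi h0 x
      _ = liebWuNeumannTermS U Q S (n + 1) x := rfl

/-- **Lieb–Wu 2003, Lemma 1 (Monotonicity in `B`): when the rapidity range increases with `Q` fixed, `σ`
decreases pointwise on all of `ℝ`.** For measurable `S ⊆ S'`: `σ_{S'} ≤ σ_S` everywhere.
[cite: LiebWuPhysicaA2003, §5, Lemma 1] -/
theorem liebWuSigmaAtS_antitone_set (hU : 0 < U) (hQ : 0 < Q) (hS : MeasurableSet S) (hS' : MeasurableSet S')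
    (hSS' : S ⊆ S') (x : ℝ) : liebWuSigmaAtS U Q S' x ≤ liebWuSigmaAtS U Q S x :=
  Summable.tsum_le_tsum (fun n => liebWuNeumannTermS_antitone_set hU hQ hS hS' hSS' n x)
    (summable_liebWuNeumannTermS hU hQ hS' x) (summable_liebWuNeumannTermS hU hQ hS x)

/-- The printed case: `0 < B ≤ B'` ⇒ `σ_{[-B',B']} ≤ σ_{[-B,B]}` pointwise. [cite: LiebWuPhysicaA2003, §5, Lemma 1] -/
theorem liebWuSigmaAtS_Icc_antitone (hU : 0 < U) (hQ : 0 < Q) {B B' : ℝ} (hBB' : B ≤ B') (x : ℝ) :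
    liebWuSigmaAtS U Q (Icc (-B') B') x ≤ liebWuSigmaAtS U Q (Icc (-B) B) x :=
  liebWuSigmaAtS_antitone_set hU hQ measurableSet_Icc measurableSet_Icc
    (Icc_subset_Icc (neg_le_neg hBB') hBB') x

/-- `B = ∞` is the extreme case: the absolute-ground-state density `liebWuSigmaAt U Q` is the smallest of all
`σ_S`. [cite: LiebWuPhysicaA2003, §5, Lemma 1] -/
theorem liebWuSigmaAt_le_liebWuSigmaAtS (hU : 0 < U) (hQ : 0 < Q) (hS : MeasurableSet S) (x : ℝ) :
    liebWuSigmaAt U Q x ≤ liebWuSigmaAtS U Q S x := by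
  rw [← liebWuSigmaAtS_univ]
  exact liebWuSigmaAtS_antitone_set hU hQ hS MeasurableSet.univ (subset_univ S) x

end Lemma1

/-! ### Consequences of Theorem 1 (uniqueness) for a general range -/

section UniquenessCorollaries

variable {U Q : ℝ} {SΛ : Set ℝ} {ρ₁ σ₁ ρ₂ σ₂ : ℝ → ℝ}

/-- **Uniqueness of the momentum density on `[-Q, Q]`** for every range. [cite: LiebWuPhysicaA2003, §5, Theorem 1] -/
theorem IsLiebWuDensities.rho_unique_on (hU : 0 < U) (hS : MeasurableSet SΛ)
    (h₁ : IsLiebWuDensities U Q SΛ ρ₁ σ₁) (h₂ : IsLiebWuDensities U Q SΛ ρ₂ σ₂) {k : ℝ} (hk : k ∈ Icc (-Q) Q) :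
    ρ₁ k = ρ₂ k := by
  rw [h₁.rho_eq_conv_indicator hS hk, h₂.rho_eq_conv_indicator hS hk]
  have hσ : SΛ.indicator σ₁ = SΛ.indicator σ₂ := by
    funext t
    by_cases ht : t ∈ SΛ
    · rw [indicator_of_mem ht, indicator_of_mem ht, IsLiebWuDensities.sigma_unique_on hU hS h₁ h₂ ht]
    · rw [indicator_of_notMem ht, indicator_of_notMem ht]
  rw [hσ]

/-- Consequently the filling (15), the energy per site (17) and the down-spin density (16) of a solution are
determined by `(U, Q, SΛ)`. [cite: LiebWuPhysicaA2003, §5, Theorem 1] -/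
theorem IsLiebWuDensities.functionals_unique_on (hU : 0 < U) (hS : MeasurableSet SΛ)
    (h₁ : IsLiebWuDensities U Q SΛ ρ₁ σ₁) (h₂ : IsLiebWuDensities U Q SΛ ρ₂ σ₂) :
    liebWuFilling Q ρ₁ = liebWuFilling Q ρ₂ ∧ liebWuEnergyPerSite Q ρ₁ = liebWuEnergyPerSite Q ρ₂ ∧
      liebWuDownSpinDensity SΛ σ₁ = liebWuDownSpinDensity SΛ σ₂ := by
  have h : ∀ k ∈ uIcc (-Q) Q, ρ₁ k = ρ₂ k := fun k hk =>
    IsLiebWuDensities.rho_unique_on hU hS h₁ h₂ (by rwa [uIcc_of_le (by linarith [h₁.cutoff_pos])] at hk)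
  refine ⟨intervalIntegral.integral_congr h, ?_, ?_⟩
  · rw [liebWuEnergyPerSite, liebWuEnergyPerSite]
    congr 1
    exact intervalIntegral.integral_congr fun k hk => by rw [h k hk]
  · rw [liebWuDownSpinDensity, liebWuDownSpinDensity]
    exact setIntegral_congr_fun hS fun t ht => IsLiebWuDensities.sigma_unique_on hU hS h₁ h₂ ht

/-- **Every solution is the Neumann-series solution** (Theorem 1 for an admissible range `SΛ = [-B, B]` or `ℝ`):
`σ = liebWuSigmaAtS U Q SΛ` on `SΛ` and `ρ = liebWuRhoAtS U Q SΛ` on `[-Q, Q]`.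
[cite: LiebWuPhysicaA2003, §5, Theorem 1] -/
theorem IsLiebWuDensities.eq_neumann_of_range (hU : 0 < U) {ρ σ : ℝ → ℝ} (h : IsLiebWuDensities U Q SΛ ρ σ) :
    (∀ Λ ∈ SΛ, σ Λ = liebWuSigmaAtS U Q SΛ Λ) ∧ ∀ k ∈ Icc (-Q) Q, ρ k = liebWuRhoAtS U Q SΛ k := by
  have hS : MeasurableSet SΛ := by
    rcases h.range_eq with ⟨B, _, rfl⟩ | rfl
    · exact measurableSet_Icc
    · exact MeasurableSet.univ
  have h' := isLiebWuDensities_liebWuRhoAtS_of_range hU h.cutoff_pos h.cutoff_le_pi h.range_eq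
  exact ⟨fun Λ hΛ => IsLiebWuDensities.sigma_unique_on hU hS h h' hΛ,
    fun k hk => IsLiebWuDensities.rho_unique_on hU hS h h' hk⟩

/-- **Statement (a), all allowed `B` and `Q`, positivity of `σ`:** every solution has `σ > 0` on its range.
[cite: LiebWuPRL1968, statement (a)] -/
theorem IsLiebWuDensities.sigma_pos_on (hU : 0 < U) {ρ σ : ℝ → ℝ} (h : IsLiebWuDensities U Q SΛ ρ σ)
    {Λ : ℝ} (hΛ : Λ ∈ SΛ) : 0 < σ Λ := by
  have hS : MeasurableSet SΛ := by
    rcases h.range_eq with ⟨B, _, rfl⟩ | rfl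
    · exact measurableSet_Icc
    · exact MeasurableSet.univ
  rw [(h.eq_neumann_of_range hU).1 Λ hΛ]
  exact liebWuSigmaAtS_pos hU h.cutoff_pos hS Λ

end UniquenessCorollaries

end Literature.MathematicalPhysics.QuantumLattice

end
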